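import Summits.NavierStokesRegularity.NavierStokesRegularity.Theses.DirectionDissipationQuantum
import Literature.Analysis.FluidPDE.DirectionDissipation
import HarnessLib.Audit

/-!
# Birth skeleton (BC3) of the crux `DirectionDissipationQuantum.GeometricEpsilonRegularity`

(crux item `stmt-NavierStokesRegularity-1920`, rank 2, route
`route-NavierStokesRegularity-DirectionDissipationQuantum`; tree path
`Cruxes/GeometricEpsilonRegularity/Lines/birth.lean`; registrar
`planner-skel-stmt-NavierStokesRegularity-1920-0`, 2026-08-17. The route predates the Lean birth certificate;
this file supplies BC3 retroactively. No `Disproof.lean`, no idea card and no other crux workfile existed at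
registration time (`ledger crux ls`: no workfiles), so there is no `_false_without_` obstruction to honour yet.)

THE CRUX (A, geometric ε-regularity, strong form). There is an absolute `ε > 0` such that for every `T > 0`,
every classical solution `(u, p)` of NS (`ν = 1`, `f = 0`) on `ℝ³ × [0,T)` which is Leray–Hopf from a rapidly
decaying datum, and every `x`: if the scaled direction dissipation
`G(r) = G(r,(T,x);u) = r⁻¹ ∫∫_{Q_r(T,x)} |ω| |∇ξ|²` (`Literature.Analysis.FluidPDE.scaledDirectionDissipation`,
`rfl`-equal to the route's inline expression by `scaledDirectionDissipation_eq`) satisfies `G(r) ≤ ε` for all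
`r ∈ (0, r₀)`, then `u` is bounded on some backward cylinder `Q_r(T,x)` (BDD).

THE CUT — landing criterion + regime decomposition of the LOAD PROFILE `r ↦ C(r)`,
`C(r) = r⁻² ∫∫_{Q_r(T,x)} |u|³` (`Literature.Analysis.FluidPDE.cknC`, the scaled `L³` load), at the point.
This is the route's own foreseen Layer-2 split "A ↦ (Type-I rung) + (Type-II exclusion at G-small points)"
(route header, Two-layer plan), typed pointwise (Type I AT THE POINT = a load ceiling `sup_{r<r₁} C(r) < ∞`,
Seregin's local Type-I notion, cf. `Literature.Analysis.FluidPDE.Seregin2020.scaledEnergies_bounded_of_cknC_le_unif`)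
and landed through the card's mechanism (small direction dissipation DEPLETES the load; a load-small point is
regular by the `L³`-type ε-regularity criterion):

* `stub_loadEpsilonRegularity` [M/L, provable now from tree material; the LANDING CRITERION]: there is an
  absolute `η > 0` such that, for the class above and any `x`, `C(r) ≤ η` for all `r ∈ (0, r₁)` forces BDD at
  `(T,x)`. This is Gustafson–Kang–Tsai 2007, Thm 1.1 with `(p,q) = (3,3)` (arXiv:math/0607114 pp. 2–4;
  `limsup_{r→0} r⁻²∫∫_{Q_r}|u|³ ≤ ε ⇒ regular`), transported to the global classical Leray–Hopf class at the
  TOP time: suitability of `(u, p_phys)` on `(0,T) × ℝ³`, smallness of the pressure load `D` at a smaller scale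
  from smallness of `C` at all small scales (Seregin–Šverák pressure decay, in tree
  `seregin_sverak_pressure_decay_holds`, `cknD_iterate_le_of_pressure_decay`), then the one-scale criterion
  (in tree, PROVED: `Literature.Analysis.FluidPDE.oneScaleRegularity_holds`, CKN 1982 Prop. 1 / RRS 2016 Thm 15.4)
  on cylinders `Q_r(T−δ,x)` uniformly in `δ ↓ 0`, continuity of `u` below `T`. Why it might fail: only
  bookkeeping — the pressure in the class is the classical one (normalise to the Leray pressure
  `p = R_iR_j(u_iu_j)`, which lies in `L^{3/2}_{loc}` up to the top time), cylinders touching `t = T`.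
* `stub_typeIDepletion` [L/XL, OPEN; regime `limsup_{r→0} C(r) < ∞` — Type I at the point]: for every
  `η > 0` there is `ε > 0` (uniform in the ceiling!) such that a load ceiling `C(r) ≤ M₁ (0 < r < r₁)` together
  with `G(r) ≤ ε (0 < r < r₀)` forces `C(r) ≤ η` at all small scales. The ε-version, at the level of the load,
  of the route's rank-3 crux `TypeIDirectionCriterion` (which assumes the global Type-I RATE and `G → 0`):
  under the ceiling the top-centred zooms `λ u(T + λ²s, x + λy)` are precompact (Seregin: ceiling on `C` ⇒
  ceiling on `A + D + E`, `scaledEnergies_bounded_of_cknC_le_unif`; local-energy compactness), `G` and `C` are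
  scale invariant (`scaledDirectionDissipation_nsZoom_center`), so every zoom limit is a local-energy ancient
  solution with `G_∞(ρ) ≤ ε` for EVERY `ρ > 0`; the missing theorem is the SMALL-DIRECTION-DISSIPATION GAP:
  such limits vanish (for `ε = 0`: `ξ̄` locally constant, `div ω̄ = 0` ⇒ 2.5D ⇒ the route's support item
  `UnidirectionalAncientLiouville` on the PROVED in-tree KNSS planar Liouville theorem), whence `C(r) → 0`.
  Why it might fail: the gap `ε(η)` must be UNIFORM in the ceiling `M₁` (inherited from the absolute `ε` of the
  crux; compactness alone gives `ε = ε(η, M₁)`), and passing `G ≤ ε` to the limit needs `C¹_loc` convergence of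
  the vorticity near zeros of `ω̄` (Fatou only gives `≤`, which is the right direction).
* `stub_typeIIQuantum` [XL, OPEN; regime `limsup_{r→0} C(r) = ∞` — genuinely Type II at the point; the
  irreducible core]: there is an absolute `ε > 0` such that no point of the class carries UNBOUNDED load along
  a sequence of scales (`∀ M₁ r₁, ∃ r < r₁, C(r) > M₁`) while `G(r) ≤ ε` at all small scales — stated with the
  crux's conclusion BDD (which contradicts unbounded load: BDD ⇒ `C(r) ≤ c M³ r³ → 0`). "A Type-II
  concentration carries a QUANTUM of direction dissipation per unit parabolic length": the content of the
  crux that no compactness argument touches (no ceiling ⇒ no normalised zoom). Mechanism proposed by the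
  card: the `|ω|`-balance `(∂ₜ + u·∇ − Δ)|ω| + |ω||∇ξ|² = (ξ·Sξ)|ω|` with stretching slaved to
  `(∫|u|²|ω|φ)^{1/2} (∫|ω||∇ξ|²φ)^{1/2}` by the localised Constantin identity (div ω = 0). Why it might fail
  (route header): the `L¹`-vorticity level is the excluded Calderón–Zygmund corner `(p,q) = (1,∞)` of
  GKT2007 Thm 1.1(iii); a nearly-2.5D Type-II concentration with tiny twist (`G → 0`, `E → ∞`) is not
  excluded by any perturbative "2D + small" theorem.

`GeometricEpsilonRegularity_of : GeometricEpsilonRegularity` (the ONLY theorem of this file concluding the crux;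
A12 layer invariant: conclusion = the crux BY NAME, no `Prop` hypotheses, placeholders only inside the three
declared stubs, which it uses by name) is the real composition: `η` from the landing stub, `ε₁ = ε₁(η)` from
the Type-I depletion stub, `ε₂` from the Type-II quantum stub, `ε := min ε₁ ε₂`; smallness of `G` is antitone
in the threshold (`ENNReal.ofReal_le_ofReal`); excluded middle on the load ceiling: ceiling ⇒ depletion ⇒
`C ≤ η` at small scales ⇒ landing ⇒ BDD; no ceiling (`push Not`) ⇒ quantum stub ⇒ BDD. Its CLOSED twin
`GeometricEpsilonRegularity_of_hyps : <sig landing> → <sig depletion> → <sig quantum> → GeometricEpsilonRegularity`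
(same proof, the stub statements as hypotheses, no placeholder anywhere) is the registrar's evidence file
`bc/GeometricEpsilonRegularity_birth_closed.lean` (attached to the crux item).

BC3 PROBES (registrar folder; route file + `Literature.Analysis.FluidPDE.DirectionDissipation` imported, the
stub statement as hypothesis `h`; `set_option maxHeartbeats 400000` per example; farm `lean check`, 2026-08-17).
Combined batteries `bc/probe_{R,D,Q}_{crux,summit}.lean`: for each stub `S ∈ {R, D, Q}` the battery
`first | exact? | simpa using h | simpa [crux] using h | aesop | (unfold crux; aesop)` against the crux
`GeometricEpsilonRegularity` and `first | exact? | simpa using h | aesop` against the summit `NavierStokesRegularity`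
FAIL (6/6: rc 1, "unsolved goals … ⊢ <target>", `aesop: failed to prove the goal after exhaustive search`).
Single-tactic files `bc/probeT_{crux,summit}.lean` (one `example` per tactic): 15/15 + 9/9 FAIL — `exact?`
"could not close the goal" ×6, `simpa using h` / `simpa [crux] using h` "Type mismatch after simplification" ×9,
`aesop` "failed to prove the goal after exhaustive search" ×6, `unfold crux; aesop` heartbeat timeout / simp
nested timeout / aesop internal error ×3. No stub is cheaply the crux or the summit: the landing stub needs LOAD
smallness, which is not direction-dissipation smallness; the depletion stub only treats ceiling points and
concludes load smallness, not boundedness; the quantum stub only treats points WITHOUT a ceiling; the crux needs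
all three (and the summit needs, beyond the crux, the route's cruxes N and the glue).

REJECTED CUTS (registrar's notes): (i) split by the GLOBAL rate `IsTypeIBlowup u T` / `¬ IsTypeIBlowup u T`
(the shape of crux B): a bounded `u` satisfies `IsTypeIBlowup` at every `T`, and a globally Type-II time can
have locally Type-I points, so the global dichotomy does not match the tools (zoom compactness is pointwise);
(ii) a pure transfer "∀ η ∃ ε: `G ≤ ε` at small scales ⇒ `C ≤ η` at small scales" for ALL points + landing:
two stubs only, and in the no-ceiling regime the transfer's `η` is vacuous (its conclusion contradicts the
regime), so the honest statement there is the quantum stub; (iii) one-scale variants ("`G(r) ≤ ε` at ONE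
scale ⇒ …") are refutable in kind by smooth flows with straight vortex lines at one scale and are not what the
crux says.
-/

noncomputable section

open MeasureTheory Filter Topology
open Literature.Analysis.FluidPDE

namespace Summit.NavierStokesRegularity.NavierStokesRegularity.Cruxes.GeometricEpsilonRegularity.Birth

set_option linter.unusedVariables false
set_option linter.dupNamespace false

/-- **stub R — `stub_loadEpsilonRegularity` (the landing criterion; M/L, provable from tree material).**
There is an absolute `η > 0` such that for every `T > 0`, every classical solution `(u,p)` of NS (`ν = 1`,
`f = 0`) on `ℝ³ × [0,T)` which is Leray–Hopf from a rapidly decaying datum, and every `x`: if the scaled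
`L³` load `C(r) = cknC r (T,x) u = r⁻² ∫∫_{Q_r(T,x)} |u|³` satisfies `C(r) ≤ η` for all `r ∈ (0,r₁)`, then
`u` is bounded on some backward cylinder `Q_r(T,x)`. Gustafson–Kang–Tsai 2007 Thm 1.1, `(p,q) = (3,3)`
(arXiv:math/0607114), at the top time of the global classical Leray–Hopf class; in-tree engines
`oneScaleRegularity_holds` (CKN 1982 Prop. 1), `seregin_sverak_pressure_decay_holds`. -/
theorem stub_loadEpsilonRegularity :
    ∃ η : ℝ, 0 < η ∧ ∀ T : ℝ, 0 < T →
      ∀ (u : ℝ → EuclideanSpace ℝ (Fin 3) → EuclideanSpace ℝ (Fin 3)) (p : ℝ → EuclideanSpace ℝ (Fin 3) → ℝ),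
      Literature.Analysis.FluidPDE.IsClassicalNSSolutionOn (Set.Ico 0 T) 1 0 u p →
      Literature.Analysis.FluidPDE.IsLerayHopfOn T 1 0 (u 0) u →
      Literature.Analysis.FluidPDE.HasRapidSpatialDecay (u 0) →
      ∀ x : EuclideanSpace ℝ (Fin 3),
      (∃ r₁ : ℝ, 0 < r₁ ∧ ∀ r ∈ Set.Ioo 0 r₁,
          Literature.Analysis.FluidPDE.cknC r ((T, x) : ℝ × EuclideanSpace ℝ (Fin 3)) u ≤ ENNReal.ofReal η) →
      ∃ r : ℝ, 0 < r ∧ ∃ M : ℝ, ∀ t ∈ Set.Ioo (T - r ^ 2) T, ∀ y ∈ Metric.ball x r, ‖u t y‖ ≤ M := by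
  sorry

/-- **stub D — `stub_typeIDepletion` (regime `limsup_{r→0} C(r) < ∞`, Type I at the point: small direction
dissipation depletes the load; L/XL, OPEN).** For every `η > 0` there is `ε > 0` such that for every `T > 0`,
every classical solution `(u,p)` of NS (`ν = 1`, `f = 0`) on `ℝ³ × [0,T)` which is Leray–Hopf from a rapidly
decaying datum, and every `x`: a load ceiling `cknC r (T,x) u ≤ M₁` for `r ∈ (0,r₁)` together with
`G(r) = scaledDirectionDissipation r (T,x) u ≤ ε` for `r ∈ (0,r₀)` forces `cknC r (T,x) u ≤ η` for all
`r ∈ (0,r₂)`, some `r₂ > 0`. The ε-version (uniform in the ceiling `M₁`) of the route's Type-I rung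
`TypeIDirectionCriterion`: top-centred zoom compactness under the ceiling
(`Seregin2020.scaledEnergies_bounded_of_cknC_le_unif`, BarkerPrange2020 Thm 3, arXiv:1906.08225) + a
small-direction-dissipation gap/Liouville theorem for local-energy ancient solutions (for `ε = 0`: the route's
support item `UnidirectionalAncientLiouville` on the in-tree KNSS planar Liouville theorem). -/
theorem stub_typeIDepletion :
    ∀ η : ℝ, 0 < η → ∃ ε : ℝ, 0 < ε ∧ ∀ T : ℝ, 0 < T →
      ∀ (u : ℝ → EuclideanSpace ℝ (Fin 3) → EuclideanSpace ℝ (Fin 3)) (p : ℝ → EuclideanSpace ℝ (Fin 3) → ℝ),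
      Literature.Analysis.FluidPDE.IsClassicalNSSolutionOn (Set.Ico 0 T) 1 0 u p →
      Literature.Analysis.FluidPDE.IsLerayHopfOn T 1 0 (u 0) u →
      Literature.Analysis.FluidPDE.HasRapidSpatialDecay (u 0) →
      ∀ x : EuclideanSpace ℝ (Fin 3),
      (∃ M₁ r₁ : ℝ, 0 < r₁ ∧ ∀ r ∈ Set.Ioo 0 r₁,
          Literature.Analysis.FluidPDE.cknC r ((T, x) : ℝ × EuclideanSpace ℝ (Fin 3)) u ≤ ENNReal.ofReal M₁) →
      (∃ r₀ : ℝ, 0 < r₀ ∧ ∀ r ∈ Set.Ioo 0 r₀,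
          Literature.Analysis.FluidPDE.scaledDirectionDissipation r ((T, x) : ℝ × EuclideanSpace ℝ (Fin 3)) u ≤
            ENNReal.ofReal ε) →
      ∃ r₂ : ℝ, 0 < r₂ ∧ ∀ r ∈ Set.Ioo 0 r₂,
          Literature.Analysis.FluidPDE.cknC r ((T, x) : ℝ × EuclideanSpace ℝ (Fin 3)) u ≤ ENNReal.ofReal η := by
  sorry

/-- **stub Q — `stub_typeIIQuantum` (regime `limsup_{r→0} C(r) = ∞`, Type II at the point: a quantum of
direction dissipation; XL, OPEN; the irreducible core of the crux).** There is an absolute `ε > 0` such that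
for every `T > 0`, every classical solution `(u,p)` of NS (`ν = 1`, `f = 0`) on `ℝ³ × [0,T)` which is
Leray–Hopf from a rapidly decaying datum, and every `x`: if the load `cknC r (T,x) u` exceeds every bound along
some sequence of scales `r → 0` (no Type-I ceiling at the point) and `G(r) = scaledDirectionDissipation r (T,x) u
≤ ε` for all `r ∈ (0,r₀)`, then `u` is bounded on some backward cylinder `Q_r(T,x)` (which in turn contradicts
the unbounded load: the stub says such points do not exist). Card mechanism: CKN/Lin iteration at the level of
the `|ω|`-balance, stretching slaved to `(∫|u|²|ω|φ)^{1/2}(∫|ω||∇ξ|²φ)^{1/2}` by the localised Constantin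
identity (Constantin1990; book:cannone2006 p. 47); risk: the excluded CZ corner `(1,∞)` of GKT2007 Thm 1.1(iii). -/
theorem stub_typeIIQuantum :
    ∃ ε : ℝ, 0 < ε ∧ ∀ T : ℝ, 0 < T →
      ∀ (u : ℝ → EuclideanSpace ℝ (Fin 3) → EuclideanSpace ℝ (Fin 3)) (p : ℝ → EuclideanSpace ℝ (Fin 3) → ℝ),
      Literature.Analysis.FluidPDE.IsClassicalNSSolutionOn (Set.Ico 0 T) 1 0 u p →
      Literature.Analysis.FluidPDE.IsLerayHopfOn T 1 0 (u 0) u →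
      Literature.Analysis.FluidPDE.HasRapidSpatialDecay (u 0) →
      ∀ x : EuclideanSpace ℝ (Fin 3),
      (∀ M₁ r₁ : ℝ, 0 < r₁ → ∃ r ∈ Set.Ioo 0 r₁,
          ENNReal.ofReal M₁ < Literature.Analysis.FluidPDE.cknC r ((T, x) : ℝ × EuclideanSpace ℝ (Fin 3)) u) →
      (∃ r₀ : ℝ, 0 < r₀ ∧ ∀ r ∈ Set.Ioo 0 r₀,
          Literature.Analysis.FluidPDE.scaledDirectionDissipation r ((T, x) : ℝ × EuclideanSpace ℝ (Fin 3)) u ≤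
            ENNReal.ofReal ε) →
      ∃ r : ℝ, 0 < r ∧ ∃ M : ℝ, ∀ t ∈ Set.Ioo (T - r ^ 2) T, ∀ y ∈ Metric.ball x r, ‖u t y‖ ≤ M := by
  sorry

/-- **Birth composition (the skeleton theorem).** The crux BY NAME from the three registered stubs, used by
name: `η` from the landing stub, `ε₁(η)` from the Type-I depletion stub, `ε₂` from the Type-II quantum stub,
`ε := min ε₁ ε₂`; smallness of `G` is antitone in the threshold; excluded middle on the load ceiling at the
point. The same proof with the stub STATEMENTS as hypotheses — a closed theorem — is the registrar's evidence
file `bc/GeometricEpsilonRegularity_birth_closed.lean`. -/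
theorem GeometricEpsilonRegularity_of : Theses.DirectionDissipationQuantum.GeometricEpsilonRegularity := by
  have hR := stub_loadEpsilonRegularity
  have hD := stub_typeIDepletion
  have hQ := stub_typeIIQuantum
  obtain ⟨η, hη, hRη⟩ := hR
  obtain ⟨ε₁, hε₁, hDε⟩ := hD η hη
  obtain ⟨ε₂, hε₂, hQε⟩ := hQ
  refine ⟨min ε₁ ε₂, lt_min hε₁ hε₂, ?_⟩
  intro T hT u p hcl hLH hdec x hG
  -- the smallness hypothesis of the crux, read through the notion `scaledDirectionDissipation` (`rfl`)
  have hG' : ∀ ε : ℝ, min ε₁ ε₂ ≤ ε → ∃ r₀ : ℝ, 0 < r₀ ∧ ∀ r ∈ Set.Ioo 0 r₀,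
      scaledDirectionDissipation r ((T, x) : ℝ × EuclideanSpace ℝ (Fin 3)) u ≤ ENNReal.ofReal ε := by
    intro ε hε
    obtain ⟨r₀, hr₀, hGr⟩ := hG
    refine ⟨r₀, hr₀, fun r hr => ?_⟩
    rw [scaledDirectionDissipation_eq]
    exact (hGr r hr).trans (ENNReal.ofReal_le_ofReal hε)
  -- regime (I): a load ceiling at the point — depletion, then the landing criterion
  by_cases hceil : ∃ M₁ r₁ : ℝ, 0 < r₁ ∧ ∀ r ∈ Set.Ioo 0 r₁,
      cknC r ((T, x) : ℝ × EuclideanSpace ℝ (Fin 3)) u ≤ ENNReal.ofReal M₁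
  · exact hRη T hT u p hcl hLH hdec x
      (hDε T hT u p hcl hLH hdec x hceil (hG' ε₁ (min_le_left ε₁ ε₂)))
  -- regime (II): no ceiling — the load is unbounded along a sequence of scales
  · push Not at hceil
    exact hQε T hT u p hcl hLH hdec x (fun M₁ r₁ hr₁ => hceil M₁ r₁ hr₁) (hG' ε₂ (min_le_right ε₁ ε₂))

end Summit.NavierStokesRegularity.NavierStokesRegularity.Cruxes.GeometricEpsilonRegularity.Birth

end
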